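import Mathlib
import Summits.Ventures.PercRepro2.Harris
import Summits.Ventures.PercRepro2.BasePrime
import Summits.Ventures.PercRepro2.LocRows
import Summits.Ventures.PercRepro2.SwRow
import Summits.Ventures.PercRepro2.SwOut
import Summits.Ventures.PercRepro2.SwAllRow
import Summits.Ventures.PercRepro2.SwOutAll
import Summits.Ventures.PercRepro2.SwOutCube
import Summits.Ventures.PercRepro2.SwOutMixedCubeFarDefs
import Summits.Ventures.PercRepro2.SwOutBigBlockDefs
import Summits.Ventures.PercRepro2.SwOutBigBlockCube

/-!
# The big-block principle, edge-set form (blind cell PercRepro2, night-4 g17, 2026-08-27;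
proofs/NIGHT4-G17.md §4″–§4‴)

The interface between the abstract big-block lemma `bigBlock_card_le` and a class of
configurations: a block `C` of configurations that is the injective image of the NON-LEAKING points
of the raw cube `Pt ι κ` under a realisation `r`, on which the red edge set of `h` is the image of
the abstract red set `ER` under a monotone map `φ` of atom sets to edge sets (and the blue edge set
the image of `EB`), and whose conditioning pulls back to a lower set with `G4`, satisfies the rigid
counting inequality on `C ∩ Qs` for every up-set `𝓔` of edge sets (`card_le_of_bigBlock_edges`) —
the analogue of `card_le_of_cube_edges` for the two-cube block.  The geometric chain of the mixed
single junction only has to build `r` and `φ` and check these hypotheses.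
-/

namespace Summit.Ventures.PercRepro2

namespace BigBlock

open LocRows

open scoped Classical

variable {V : Type*} {E : Type*} [Fintype E] [DecidableEq E] {ends : E → Sym2 V}
variable {ι κ : Type*} [Fintype ι] [DecidableEq ι] [Fintype κ] [DecidableEq κ]

omit [DecidableEq E] in
/-- **The big-block principle, edge-set form**. -/
theorem card_le_of_bigBlock_edges (r : Pt ι κ → Config E)
    (hr : ∀ p q, ¬ Leak p → ¬ Leak q → r p = r q → p = q) (C : Finset (Config E))
    (hC : ∀ ζ, ζ ∈ C ↔ ∃ p, ¬ Leak p ∧ r p = ζ) (Qs : Set (Config E))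
    (hEv : IsLowerSet {p | r p ∈ Qs}) (hG : G4 {p | r p ∈ Qs}) (h : V)
    (φ : Set (Atom ι κ) → Set E) (hφ : Monotone φ)
    (hR : ∀ p, ¬ Leak p → redEdges ends (r p) h = φ (ER p))
    (hB : ∀ p, ¬ Leak p → blueEdges ends (r p) h = φ (EB p))
    {𝓔 : Set (Set E)} (h𝓔 : IsUpperSet 𝓔) :
    (C.filter fun ζ => ζ ∈ Qs ∧ redEdges ends ζ h ∈ 𝓔).card ≤
      (C.filter fun ζ => ζ ∈ Qs ∧ blueEdges ends ζ h ∈ 𝓔).card := by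
  -- the class counts are counts over the non-leaking points of the cube
  have e1 : (C.filter fun ζ => ζ ∈ Qs ∧ redEdges ends ζ h ∈ 𝓔) =
      (Finset.univ.filter fun p : Pt ι κ => r p ∈ Qs ∧ ¬ Leak p ∧ ER p ∈ φ ⁻¹' 𝓔).image r := by
    ext ζ
    simp only [Finset.mem_filter, Finset.mem_image, Finset.mem_univ, true_and, Set.mem_preimage]
    constructor
    · rintro ⟨hζ, hQ, hE⟩
      obtain ⟨p, hp, rfl⟩ := (hC ζ).1 hζ
      refine ⟨p, ⟨hQ, hp, ?_⟩, rfl⟩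
      rw [← hR p hp]; exact hE
    · rintro ⟨p, ⟨hQ, hp, hE⟩, rfl⟩
      refine ⟨(hC _).2 ⟨p, hp, rfl⟩, hQ, ?_⟩
      rw [hR p hp]; exact hE
  have e2 : (C.filter fun ζ => ζ ∈ Qs ∧ blueEdges ends ζ h ∈ 𝓔) =
      (Finset.univ.filter fun p : Pt ι κ => r p ∈ Qs ∧ ¬ Leak p ∧ EB p ∈ φ ⁻¹' 𝓔).image r := by
    ext ζ
    simp only [Finset.mem_filter, Finset.mem_image, Finset.mem_univ, true_and, Set.mem_preimage]
    constructor
    · rintro ⟨hζ, hQ, hE⟩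
      obtain ⟨p, hp, rfl⟩ := (hC ζ).1 hζ
      refine ⟨p, ⟨hQ, hp, ?_⟩, rfl⟩
      rw [← hB p hp]; exact hE
    · rintro ⟨p, ⟨hQ, hp, hE⟩, rfl⟩
      refine ⟨(hC _).2 ⟨p, hp, rfl⟩, hQ, ?_⟩
      rw [hB p hp]; exact hE
  -- `r` is injective on the non-leaking points
  have inj1 : Set.InjOn r
      ↑(Finset.univ.filter fun p : Pt ι κ => r p ∈ Qs ∧ ¬ Leak p ∧ ER p ∈ φ ⁻¹' 𝓔) := by
    intro p hp q hq hpq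
    simp only [Finset.coe_filter, Finset.mem_univ, true_and, Set.mem_setOf_eq] at hp hq
    exact hr p q hp.2.1 hq.2.1 hpq
  have inj2 : Set.InjOn r
      ↑(Finset.univ.filter fun p : Pt ι κ => r p ∈ Qs ∧ ¬ Leak p ∧ EB p ∈ φ ⁻¹' 𝓔) := by
    intro p hp q hq hpq
    simp only [Finset.coe_filter, Finset.mem_univ, true_and, Set.mem_setOf_eq] at hp hq
    exact hr p q hp.2.1 hq.2.1 hpq
  rw [e1, e2, Finset.card_image_of_injOn inj1, Finset.card_image_of_injOn inj2]
  -- the pulled-back up-set of atom sets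
  have h𝓔' : IsUpperSet (φ ⁻¹' 𝓔) := by
    intro S S' hSS' hS
    exact h𝓔 (hφ hSS') hS
  exact bigBlock_card_le hEv h𝓔' hG

end BigBlock

end Summit.Ventures.PercRepro2
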